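import Literature.Geometry.Riemannian.RicciFlowThroughSingularitiesFour
import Literature.Geometry.Riemannian.HeatEquationFamily
import Literature.Geometry.Riemannian.CutLocusProofs
import HarnessLib

/-!
# Bamler's distance-distortion estimate `(∂ₜ − Δ_x − Δ_y) d_t²(x, y) ≥ −H_n` in the barrier sense
# (Bamler 2020a, Thm. 3.5) — named fact

R. Bamler, *Entropy and heat kernel bounds on a Ricci flow background*, arXiv:2008.07093 (2020a),
§3.1, **Theorem 3.5**: "Let `(M, (g_t)_{t ∈ I})` be a super Ricci flow on a compact
`n`-manifold. Then `(∂ₜ − Δ_{g_t, x} − Δ_{g_t, y}) d_t²(x, y) ≥ −H_n`,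
`H_n = (n − 1)π²/2 + 4`, in the viscosity sense and even in the following barrier sense: for every
`(x, y, t)` and `ε > 0` there is a neighbourhood of `(x, y, t)` in `M × M × I` and a smooth upper
barrier `b ≥ d` on it with equality at `(x, y, t)` and `(∂ₜ − Δ_x − Δ_y) b²(x, y, t) ≥ −H_n − ε`"
(proof in §3.2: for `x, y` not in each other's cut locus `d²` is smooth near `(x, y, t)`,
`∂ₜ d_t² ≥ −2d ∫ Ric(γ′, γ′)` and the second variations along `sin(πs/2d) eᵢ(s)` give
`(Δ_x + Δ_y) d² ≤ (n−1)π²/2 + 4 − …`; cut pairs are handled by Calabi's trick of moving the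
endpoints of the minimising geodesic inwards; `x = y` is the smooth case `−4n ≥ −H_n`).

This file states the barrier form as a NAMED FACT for the tree's Ricci flows of Riemannian
metrics (`IsRicciFlow`, a special case of super Ricci flows) given by a `C^∞` global family `h`
on a closed connected manifold modelled on `ℝᵐ` (`n = m ≥ 1`), in exactly the shape consumed by the
barrier minimum principle (`BarrierMinimumPrinciple.lean`) and by
`isHConcentrated_ricciFlowMetricFlow_of_barrier` (`HConcentrationOfBarrier.lean`): at every
`(x, y, r)` with `r ∈ S` not the initial time and every `η > 0` there is `b : M → M → ℝ → ℝ`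
dominating `d²` on a neighbourhood of `(x, y, r)` in `M × M × ℝ`, touching at the point, with
`C²` slices in `x` and in `y` near the point, differentiable in time at `r`, and
`∂ₜb − Δ_x b − Δ_y b ≥ −H_m − η` at `(x, y, r)` (`H_m = MetricFlow.concentrationConst m`).

No `_holds` here: the proof needs the second variation of energy along a minimising geodesic with
the `sin`-fields, the first variation of `t ↦ d_t` under `∂ₜg = −2Ric`, smooth dependence of the
distance on the metric near non-cut pairs, and Calabi's endpoint trick (tree: `ExpMapSecondVariation`,
`EnergySecondVariation*`, `HaslhoferMuller.edist_toReal_le_taylor`, `CutLocus*`) — an XL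
assembly left to a dedicated line. Users take `(hV : bamler_distSq_heatOperator_barrier)`.

## References

* R. H. Bamler, *Entropy and heat kernel bounds on a Ricci flow background*, arXiv:2008.07093
  (2020), §3.1 Thm. 3.5, §3.2 (proof). [Bamler2020Entropy]
-/

noncomputable section

open Bundle Set Function Filter Manifold TopologicalSpace
open scoped Manifold ContDiff Topology ENNReal

namespace Literature.Geometry.Riemannian

open Lorentzian Lorentzian.PseudoRiemannianMetric

universe u v

/-- **Bamler 2020a, Thm. 3.5 (barrier sense)** for Ricci flows of Riemannian metrics given by a
`C^∞` global family on a closed connected manifold modelled on `ℝᵐ`, `m ≥ 1` (for `m = 0` the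
constant `H₀ = 4 − π²/2 < 0` and the statement is void/false; the source's `n`-manifolds have
`n ≥ 1`), on an order-connected time set `S` (an interval; on a degenerate `S` the flow
equation within `S` would not determine `∂ₜh`): at every `(x, y, r)`,
`r ∈ S` not the initial time of the flow, and for every `η > 0`, the squared distance
`d_t²(x, y)` admits an upper barrier `b` near `(x, y, r)` — `d² ≤ b` on a neighbourhood in
`M × M × ℝ`, `b(x, y, r) = d_r²(x, y)`, `C²` slices in `x` and `y` near the point, differentiable
in time at `r` — with `∂ₜb − Δ_x b − Δ_y b ≥ −H_m − η` at `(x, y, r)`, `H_m = (m − 1)π²/2 + 4`.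
[cite: Bamler2020Entropy, §3.1, Thm. 3.5] -/
def bamler_distSq_heatOperator_barrier : Prop :=
  ∀ {m : ℕ} {H : Type u} [TopologicalSpace H] {I : ModelWithCorners ℝ (EuclideanSpace ℝ (Fin m)) H}
    [I.Boundaryless] {M : Type v} [TopologicalSpace M] [ChartedSpace H M] [IsManifold I ∞ M]
    [T2Space M] [CompactSpace M] [ConnectedSpace M]
    (h : ℝ → PseudoRiemannianMetric I ∞ (EuclideanSpace ℝ (Fin m)) (TangentSpace I : M → Type _))
    (hR : ∀ r, (h r).IsRiemannian)
    {cov : ℝ → CovariantDerivative I (EuclideanSpace ℝ (Fin m)) (TangentSpace I : M → Type _)}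
    {S : Set ℝ}, S.OrdConnected → 0 < m → IsContMDiffFamilyOn ∞ h univ → IsRicciFlow h cov S →
    ∀ (x y : M) (r : ℝ), r ∈ S → (∃ s ∈ S, s < r) → ∀ η : ℝ, 0 < η → ∃ b : M → M → ℝ → ℝ,
      (∀ᶠ p in 𝓝 ((x, y, r) : M × M × ℝ),
        ((h p.2.2).edist (hR p.2.2) p.1 p.2.1).toReal ^ 2 ≤ b p.1 p.2.1 p.2.2) ∧
      b x y r = ((h r).edist (hR r) x y).toReal ^ 2 ∧
      (∀ᶠ x' in 𝓝 x, ContMDiffAt I 𝓘(ℝ, ℝ) 2 (fun x'' ↦ b x'' y r) x') ∧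
      (∀ᶠ y' in 𝓝 y, ContMDiffAt I 𝓘(ℝ, ℝ) 2 (fun y'' ↦ b x y'' r) y') ∧
      ∃ db : ℝ, HasDerivAt (fun s' ↦ b x y s') db r ∧
        -MetricFlow.concentrationConst m - η ≤ db - (h r).laplaceBeltrami (fun x' ↦ b x' y r) x -
          (h r).laplaceBeltrami (fun y' ↦ b x y' r) y

end Literature.Geometry.Riemannian

end
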